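import Summits.ResolutionOfSingularities.ResolutionOfSingularities.Theorems.FrobeniusClosingSteerCriticalThreadKey
import Summits.ResolutionOfSingularities.ResolutionOfSingularities.Theorems.FrobeniusClosingSteerNoSingularCarrierStep
import HarnessLib

/-!
# Steer σ-residual, LOW half — D3a (A2): the critical-surface THREAD, part 2 — ONE STEP `Inv(R) ⇒ R' ≤ Λ ∧ Inv(R')`

OURS (campaign res-hironaka, rung L ★L-G4, slot W4.1, crux `Steer` stmt-ResolutionOfSingularities-16345; res-L0-w41-plan-1
RULING 42 (A2) «run-threading» := res-L0-w41-stub-3 g6; contract = res-D-pv-012's `hthread`/`hinv` (STATUS 09:43:57Z / 10:01:51Z);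
replaces the role of no printed item; NOT a statement of the manuscript under review [claim: Hironaka2017, status: under-review]; AI
review is weaker than expert review). Theses-free, definition-free.

`thread_step`: for a member `R` carrying the thread invariant (I1)(I3) with transported duals `δ₁, δ₂`, a centre `P` generated by a
part `y` of a regular system of parameters whose first two members are `δ₁ f, δ₂ f` ((I2) + nesting), the local blowing up `R'` along
`P` (exceptional parameter `x`, strict step `s = x s' + G`) whose new stage is SINGULAR satisfies: `x` is a unit of `Λ` (no surface step,
`φ(x) ≠ 0`); `R' = (R[P/x])_{centre}`; `R'` dominates `R`; **`R' ≤ Λ` and the invariant holds at `R'`** for `δ_j' ⊇ x·δ_j`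
(`δ_j'(s'²) = δ_j(s²)/x`): (I1') by the key lemma of part 1, (I2') by the chart brick `…SteerChartRsopPart` (de Jong 2.4), (I3') since
`δ_i'(e_j/x) ≡ δ_i e_j (mod 𝔪')`. [cite: Matsumura1987, Thm. 14.2, Thm. 16.2] [cite: DeJong1996, 2.4] [cite: NovacoskiSpivakovsky2014, Def. 2.11]
-/

noncomputable section

-- single-problem summit: the doubled namespace component `ResolutionOfSingularities` is forced
set_option linter.dupNamespace false

namespace Summit.ResolutionOfSingularities.ResolutionOfSingularities.Theorems.SwitchingDichotomy.CriticalThread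

open IsLocalRing
open Literature.AlgebraicGeometry.Resolution
open Summit.ResolutionOfSingularities.ResolutionOfSingularities.Theorems.SwitchingDichotomy

variable {K : Type} [Field K]
/-! ## §4 The step theorem -/

/-- **ONE STEP OF THE CRITICAL-SURFACE THREAD.** `R ⊆ K` regular local dominated by `O` (`a ∈ 𝔪_R ↔ v(a) < 1`),
`Λ ⊇ R` a local subring, radicand `f = s²` with derivations `δ₁, δ₂` of `R` satisfying the THREAD INVARIANT — (I1) the
non-units of `Λ` in `R` are exactly `(δ₁ f, δ₂ f)`, (I3) unit Hessian determinant — and a part `y` of a regular system of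
parameters of `R` generating the centre `P` whose first two members are `δ₁ f, δ₂ f` ((I2) + nesting). Along the local blowing
up `R'` of `R` along `P` with exceptional parameter `x` (maximal value on `P`) and strict step `s = x s' + G`, if the new stage is
SINGULAR (`s'² ≡ γ² (mod 𝔪_{R'}²)`) then: `x` is a unit of `Λ`; `R' = (R[P/x])_{𝔪_O ∩ R[P/x]}`; `R'` dominates `R` and is
dominated by `O`; and
**`R' ≤ Λ` with the invariant re-established at `R'`** for the transported derivations `δ_j' ⊇ x·δ_j`
(`δ_j'(s'²) = δ_j(s²)/x`): (I1') non-units of `Λ` in `R'` = `(δ₁' s'², δ₂' s'²)`, (I2') a part of a regular system of parameters of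
`R'`, (I3') unit Hessian. [cite: Matsumura1987, Thm. 14.2, Thm. 16.2] [cite: DeJong1996, 2.4] [cite: NovacoskiSpivakovsky2014, Def. 2.11] -/
theorem thread_step [CharP K 2] {O : ValuationSubring K} {R R' Λ : Subring K}
    [IsRegularLocalRing R] [IsLocalRing R'] [IsLocalRing Λ]
    (hval : ∀ a : R, a ∈ maximalIdeal R ↔ O.valuation (a : K) < 1)
    (hRΛ : R ≤ Λ) {s s' G x : K} (hs : s ^ 2 ∈ R) (hs' : s' ^ 2 ∈ R')
    (δ₁ δ₂ : Derivation ℤ R R)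
    (hI1 : ∀ r : R, r ∈ Ideal.span {δ₁ ⟨s ^ 2, hs⟩, δ₂ ⟨s ^ 2, hs⟩} ↔ ¬ IsUnit (⟨(r : K), hRΛ r.2⟩ : Λ))
    (hI3 : IsUnit (δ₁ (δ₁ ⟨s ^ 2, hs⟩) * δ₂ (δ₂ ⟨s ^ 2, hs⟩) - δ₁ (δ₂ ⟨s ^ 2, hs⟩) * δ₂ (δ₁ ⟨s ^ 2, hs⟩)))
    {P : Ideal R} {r : ℕ} {y : Fin (2 + r) → R} (hy : IsRsopPart y) (hyP : Ideal.span (Set.range y) = P)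
    (hy0 : y (Fin.castAdd r 0) = δ₁ ⟨s ^ 2, hs⟩) (hy1 : y (Fin.castAdd r 1) = δ₂ ⟨s ^ 2, hs⟩)
    (hbl : IsLocalBlowupAlong O R P R')
    (hxR : x ∈ R) (hxP : (⟨x, hxR⟩ : R) ∈ P) (hx0 : x ≠ 0)
    (hxmax : ∀ w : R, w ∈ P → O.valuation (w : K) ≤ O.valuation x)
    (hG : G ∈ R) (hstep : s = x * s' + G)
    (hsing : ∃ γ : R', (⟨s' ^ 2, hs'⟩ : R') - γ ^ 2 ∈ maximalIdeal R' ^ 2) :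
    IsUnit (⟨x, hRΛ hxR⟩ : Λ) ∧
    R' = locAtCentre (Subring.closure ((R : Set K) ∪ (fun w : R => (w : K) / x) '' (P : Set R))) O ∧
    SubringDominates R R' ∧
    (∀ a : R', a ∈ maximalIdeal R' ↔ O.valuation (a : K) < 1) ∧
    ∃ (hle' : R' ≤ Λ) (δ₁' δ₂' : Derivation ℤ R' R'),
      ((δ₁' ⟨s' ^ 2, hs'⟩ : R') : K) = ((δ₁ ⟨s ^ 2, hs⟩ : R) : K) / x ∧
      ((δ₂' ⟨s' ^ 2, hs'⟩ : R') : K) = ((δ₂ ⟨s ^ 2, hs⟩ : R) : K) / x ∧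
      (∀ r' : R', r' ∈ Ideal.span {δ₁' ⟨s' ^ 2, hs'⟩, δ₂' ⟨s' ^ 2, hs'⟩} ↔
        ¬ IsUnit (⟨(r' : K), hle' r'.2⟩ : Λ)) ∧
      IsRsopPart ![δ₁' ⟨s' ^ 2, hs'⟩, δ₂' ⟨s' ^ 2, hs'⟩] ∧
      IsUnit (δ₁' (δ₁' ⟨s' ^ 2, hs'⟩) * δ₂' (δ₂' ⟨s' ^ 2, hs'⟩) -
        δ₁' (δ₂' ⟨s' ^ 2, hs'⟩) * δ₂' (δ₁' ⟨s' ^ 2, hs'⟩)) := by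
  classical
  haveI : Fact (2 : ℕ).Prime := ⟨Nat.prime_two⟩
  have hle : R ≤ R' := hbl.isLocalBlowup.le
  have hRO : R ≤ O.toSubring := hbl.1
  -- §a the transported derivations and `E_j = e_j / x ∈ 𝔪'`
  obtain ⟨δ₁', hδ₁'a, hE₁, hE₁m⟩ := exists_transport hbl hxR hxP hx0 hs hs' hG hstep hsing δ₁
  obtain ⟨δ₂', hδ₂'a, hE₂, hE₂m⟩ := exists_transport hbl hxR hxP hx0 hs hs' hG hstep hsing δ₂
  set E₁ : R' := δ₁' ⟨s' ^ 2, hs'⟩ with hE₁def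
  set E₂ : R' := δ₂' ⟨s' ^ 2, hs'⟩ with hE₂def
  set e₁ : R := δ₁ ⟨s ^ 2, hs⟩ with he₁def
  set e₂ : R := δ₂ ⟨s ^ 2, hs⟩ with he₂def
  -- §b the normal form of `R'` in the `x`-chart
  set C := Subring.closure ((R : Set K) ∪ (fun w : R => (w : K) / x) '' (P : Set R)) with hCdef
  have hR'C : R' = locAtCentre C O := by
    let g : Fin (2 + r + 1) → R := Fin.cons ⟨x, hxR⟩ y
    have hg0 : g 0 = ⟨x, hxR⟩ := rfl
    have hgP : Ideal.span (Set.range g) = P := by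
      rw [Fin.range_cons, Ideal.span_insert, hyP, sup_eq_right]
      exact (Ideal.span_singleton_le_iff_mem _).mpr hxP
    have hg0' : g 0 ≠ 0 := by rw [hg0]; exact fun h => hx0 (congrArg Subtype.val h)
    have hgmax : ∀ j, O.valuation ((g j : R) : K) ≤ O.valuation ((g 0 : R) : K) := fun j => by
      rw [hg0]; exact hxmax (g j) (hgP ▸ Ideal.subset_span ⟨j, rfl⟩)
    have h' := SteeredRun.isLocalBlowupAlong_of_generators hRO g hgP 0 hg0' hgmax
    have hR' := SteeredRun.isLocalBlowupAlong_unique hbl h'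
    rw [hR', hg0, hCdef, SteeredRun.closure_union_image_div_eq_of_span_eq R x (Set.range g) hgP]
  have hCO : C ≤ O.toSubring := by
    refine Subring.closure_le.mpr ?_
    rintro z (hz | ⟨w, hw, rfl⟩)
    · exact hRO hz
    · have hv0 : O.valuation x ≠ 0 := by simpa using hx0
      change (w : K) / x ∈ O
      rw [← O.valuation_le_one_iff, map_div₀, div_le_one₀ (pos_iff_ne_zero.mpr hv0)]
      exact hxmax w hw
  have hval' : ∀ a : R', a ∈ maximalIdeal R' ↔ O.valuation (a : K) < 1 := mem_maximalIdeal_iff_of_eq hCO hR'C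
  have hCR' : C ≤ R' := chart_le_of_eq hR'C
  have hvE₁ : O.valuation ((e₁ : K) / x) < 1 := by rw [← hE₁]; exact (hval' _).mp hE₁m
  have hvE₂ : O.valuation ((e₂ : K) / x) < 1 := by rw [← hE₂]; exact (hval' _).mp hE₂m
  have hEspan_le : Ideal.span {E₁, E₂} ≤ maximalIdeal R' := by
    rw [Ideal.span_le]
    rintro t (rfl | rfl)
    · exact hE₁m
    · exact hE₂m
  -- §c `x` is a unit of `Λ`
  have hxu : IsUnit (⟨x, hRΛ hxR⟩ : Λ) := by
    by_contra hxu
    obtain ⟨a, b, hab⟩ := Ideal.mem_span_pair.mp ((hI1 ⟨x, hxR⟩).mpr hxu)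
    have habK : (a : K) * e₁ + (b : K) * e₂ = x := by
      have := congrArg Subtype.val hab; simpa using this
    have h1 : (1 : R') = ⟨(a : K), hle a.2⟩ * E₁ + ⟨(b : K), hle b.2⟩ * E₂ := by
      apply Subtype.ext
      push_cast
      rw [hE₁, hE₂]
      field_simp
      linear_combination -habK
    have hmem : (⟨(a : K), hle a.2⟩ : R') * E₁ + ⟨(b : K), hle b.2⟩ * E₂ ∈ maximalIdeal R' :=
      Ideal.add_mem _ (Ideal.mul_mem_left _ _ hE₁m) (Ideal.mul_mem_left _ _ hE₂m)
    rw [← h1] at hmem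
    exact (maximalIdeal.isMaximal R').ne_top ((Ideal.eq_top_iff_one _).mpr hmem)
  have hxinv : x⁻¹ ∈ Λ := inv_mem_of_isUnit _ hxu
  -- §d the chart lies in `Λ`; non-units of `Λ` in the chart are in `(E₁, E₂)`; `O`-units of the chart are `Λ`-units
  have hCΛ : C ≤ Λ := by
    refine Subring.closure_le.mpr ?_
    rintro z (hz | ⟨w, hw, rfl⟩)
    · exact hRΛ hz
    · change (w : K) / x ∈ Λ
      rw [div_eq_mul_inv]
      exact Λ.mul_mem (hRΛ w.2) hxinv
  have hq : ∀ t : R, ¬ IsUnit (⟨(t : K), hRΛ t.2⟩ : Λ) → t ∈ Ideal.span {e₁, e₂} := fun t ht => (hI1 t).mpr ht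
  have key : ∀ {z : K} (hz : z ∈ C), ¬ IsUnit (⟨z, hCΛ hz⟩ : Λ) → (⟨z, hCR' hz⟩ : R') ∈ Ideal.span {E₁, E₂} :=
    fun hz hzu => mem_span_quot_of_mem_chart hRΛ hq hy hyP hy0 hy1 hxR hxP hx0 hCR' hE₁ hE₂ hz (hCΛ hz) hzu
  have hunit : ∀ {w : K} (hw : w ∈ C), O.valuation w = 1 → IsUnit (⟨w, hCΛ hw⟩ : Λ) := by
    intro w hw hvw
    by_contra hwu
    have h := (hval' _).mp (hEspan_le (key hw hwu))
    exact absurd hvw (ne_of_lt h)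
  -- §e `R' ≤ Λ`
  have hle' : R' ≤ Λ := by
    intro z hz
    obtain ⟨u, hu, w, hw, hvw, rfl⟩ := exists_div_of_eq hR'C hz
    rw [div_eq_mul_inv]
    exact Λ.mul_mem (hCΛ hu) (inv_mem_of_isUnit _ (hunit hw hvw))
  -- §f `E_j` are non-units of `Λ`
  have hEΛ : ∀ {E : R'} {e : R}, ((E : K) = (e : K) / x) → e ∈ Ideal.span {e₁, e₂} →
      ¬ IsUnit (⟨(E : K), hle' E.2⟩ : Λ) := by
    intro E e hEe he
    have hne : ¬ IsUnit (⟨(e : K), hRΛ e.2⟩ : Λ) := (hI1 e).mp he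
    have h := not_isUnit_mul_of_not_isUnit (hRΛ e.2) hxinv hne
    have heq : (⟨(e : K) * x⁻¹, Λ.mul_mem (hRΛ e.2) hxinv⟩ : Λ) = ⟨(E : K), hle' E.2⟩ :=
      Subtype.ext (by rw [hEe, div_eq_mul_inv])
    rwa [heq] at h
  have hE₁Λ := hEΛ hE₁ (Ideal.subset_span (Set.mem_insert _ _))
  have hE₂Λ := hEΛ hE₂ (Ideal.subset_span (Set.mem_insert_of_mem _ (Set.mem_singleton _)))
  -- §g (I1')
  have hI1' : ∀ r' : R', r' ∈ Ideal.span {E₁, E₂} ↔ ¬ IsUnit (⟨(r' : K), hle' r'.2⟩ : Λ) := by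
    intro r'
    constructor
    · intro hr'
      obtain ⟨a, b, hab⟩ := Ideal.mem_span_pair.mp hr'
      rw [← mem_nonunits_iff, ← IsLocalRing.mem_maximalIdeal] at hE₁Λ hE₂Λ ⊢
      have heq : (⟨(r' : K), hle' r'.2⟩ : Λ) = ⟨(a : K), hle' a.2⟩ * ⟨(E₁ : K), hle' E₁.2⟩ +
          ⟨(b : K), hle' b.2⟩ * ⟨(E₂ : K), hle' E₂.2⟩ := by
        apply Subtype.ext
        have := congrArg Subtype.val hab
        simpa using this.symm
      rw [heq]
      exact Ideal.add_mem _ (Ideal.mul_mem_left _ _ hE₁Λ) (Ideal.mul_mem_left _ _ hE₂Λ)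
    · intro hr'
      obtain ⟨u, hu, w, hw, hvw, hr⟩ := exists_div_of_eq hR'C r'.2
      have hw0 : w ≠ 0 := ne_zero_of_valuation_eq_one hvw
      have hwinv : w⁻¹ ∈ R' := inv_mem_of_eq hR'C hw hvw
      -- `u = r' w` is a non-unit of `Λ`
      have huΛ : ¬ IsUnit (⟨u, hCΛ hu⟩ : Λ) := by
        have h := not_isUnit_mul_of_not_isUnit (hle' r'.2) (hCΛ hw) hr'
        have heq : (⟨(r' : K) * w, Λ.mul_mem (hle' r'.2) (hCΛ hw)⟩ : Λ) = ⟨u, hCΛ hu⟩ :=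
          Subtype.ext (by change (r' : K) * w = u; rw [hr, div_mul_cancel₀ _ hw0])
        rwa [heq] at h
      have hu' := key hu huΛ
      have heq : r' = ⟨u, hCR' hu⟩ * ⟨w⁻¹, hwinv⟩ :=
        Subtype.ext (by change (r' : K) = u * w⁻¹; rw [hr, div_eq_mul_inv])
      rw [heq]
      exact Ideal.mul_mem_right _ _ hu'
  -- §h (I2') the chart brick
  have hI2' : IsRsopPart ![E₁, E₂] := by
    -- a generator `y i` of maximal value; `x / y i` is a unit of `R'`
    have hne : ∃ j ∈ (Finset.univ : Finset (Fin (2 + r))), ((y j : R) : K) ≠ 0 :=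
      ⟨Fin.castAdd r 0, Finset.mem_univ _, fun h => hy.ne_zero _ (Subtype.ext h)⟩
    obtain ⟨i, -, hi0, hmaxi⟩ := exists_max_valuation O Finset.univ (fun j => ((y j : R) : K)) hne
    have hyi : y i ≠ 0 := fun h => hi0 (by rw [h]; rfl)
    have hmaxi' : ∀ j, O.valuation ((y j : R) : K) ≤ O.valuation ((y i : R) : K) :=
      fun j => hmaxi j (Finset.mem_univ j)
    have h'' := SteeredRun.isLocalBlowupAlong_of_generators hRO y hyP i hyi hmaxi'
    have hset : (fun w : R => (w : K) / ((y i : R) : K)) '' Set.range y =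
        Set.range fun j => ((y j : R) : K) / ((y i : R) : K) := by
      rw [← Set.range_comp]; rfl
    rw [hset] at h''
    have hR'i := SteeredRun.isLocalBlowupAlong_unique hbl h''
    have hvx : O.valuation x = O.valuation ((y i : R) : K) :=
      le_antisymm (NoSingularCarrier.valuation_le_of_mem_span_range hRO y i hmaxi' ⟨x, hxR⟩ (hyP ▸ hxP))
        (hxmax (y i) (hyP ▸ Ideal.subset_span ⟨i, rfl⟩))
    have hyi0 : ((y i : R) : K) ≠ 0 := hi0
    have hvq : O.valuation (((y i : R) : K) / x) = 1 := by
      rw [map_div₀, ← hvx, div_self]; simpa using hx0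
    have hqC : ((y i : R) : K) / x ∈ C := Subring.subset_closure (Or.inr ⟨y i, hyP ▸ Ideal.subset_span ⟨i, rfl⟩, rfl⟩)
    have hqR' : ((y i : R) : K) / x ∈ R' := hCR' hqC
    have hqinv : (((y i : R) : K) / x)⁻¹ ∈ R' := inv_mem_of_eq hR'C hqC hvq
    have hqinv' : x / ((y i : R) : K) ∈ R' := by rw [← inv_div]; exact hqinv
    -- `e_j / y i = E_j · (x / y i)`
    have hdiv : ∀ (e : R), (e : K) / ((y i : R) : K) = (e : K) / x * (x / ((y i : R) : K)) := fun e => by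
      field_simp
    have hmem : ∀ {E : R'} {e : R}, ((E : K) = (e : K) / x) → (e : K) / ((y i : R) : K) ∈ R' :=
      fun {E} {e} hEe => by rw [hdiv, ← hEe]; exact R'.mul_mem E.2 hqinv'
    have hvu : O.valuation (x / ((y i : R) : K)) = 1 := by
      rw [map_div₀, hvx, div_self ((_root_.map_ne_zero _).mpr hyi0)]
    have hv : ∀ {e : R}, O.valuation ((e : K) / x) < 1 → O.valuation ((e : K) / ((y i : R) : K)) < 1 :=
      fun {e} hve => by rw [hdiv, map_mul, hvu, mul_one]; exact hve
    have hne_i : ∀ {j : Fin (2 + r)} {e : R}, y j = e → O.valuation ((e : K) / x) < 1 → j ≠ i := by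
      rintro j e rfl hve rfl
      exact absurd hvq (ne_of_lt hve)
    have hj₁ : Fin.castAdd r 0 ≠ i := hne_i hy0 hvE₁
    have hj₂ : Fin.castAdd r 1 ≠ i := hne_i hy1 hvE₂
    have hj : Fin.castAdd r (0 : Fin 2) ≠ Fin.castAdd r 1 := fun h => by
      have := Fin.castAdd_injective _ _ h; exact absurd this (by decide)
    have hpair := ChartRsop.isRsopPart_pair_chart hRO hval y hy i hyi hmaxi' (Fin.castAdd r 0) (Fin.castAdd r 1)
      hj₁ hj₂ hj (by rw [hy0]; exact hv hvE₁) (by rw [hy1]; exact hv hvE₂) R' hR'i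
      (by rw [hy0]; exact hmem hE₁) (by rw [hy1]; exact hmem hE₂)
    -- transport along the unit `y i / x`
    let uu : R'ˣ := Units.mkOfMulEqOne ⟨((y i : R) : K) / x, hqR'⟩ ⟨x / ((y i : R) : K), hqinv'⟩
      (Subtype.ext (by
        change ((y i : R) : K) / x * (x / ((y i : R) : K)) = 1
        field_simp))
    refine hpair.of_associated fun k => ?_
    fin_cases k
    · refine ⟨uu, Subtype.ext ?_⟩
      change ((y (Fin.castAdd r 0) : R) : K) / ((y i : R) : K) * (((y i : R) : K) / x) = (E₁ : K)
      rw [hy0, hE₁]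
      field_simp
    · refine ⟨uu, Subtype.ext ?_⟩
      change ((y (Fin.castAdd r 1) : R) : K) / ((y i : R) : K) * (((y i : R) : K) / x) = (E₂ : K)
      rw [hy1, hE₂]
      field_simp
  -- §i (I3') the Hessian determinant stays a unit
  have hI3' : IsUnit (δ₁' E₁ * δ₂' E₂ - δ₁' E₂ * δ₂' E₁) := by
    -- `δ_i' E_j = δ_i e_j − (δ_i x)·E_j` in `R'`
    have hformula : ∀ (δ : Derivation ℤ R R) (δ' : Derivation ℤ R' R')
        (hδ'a : ∀ a : R, ((δ' ⟨(a : K), hbl.isLocalBlowup.le a.2⟩ : R') : K) = x * ((δ a : R) : K))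
        {E : R'} {e : R} (hEe : (E : K) = (e : K) / x),
        δ' E = Subring.inclusion hle (δ e) - Subring.inclusion hle (δ ⟨x, hxR⟩) * E := by
      intro δ δ' hδ'a E e hEe
      have hxE : (⟨x, hle hxR⟩ : R') * E = ⟨(e : K), hle e.2⟩ := by
        apply Subtype.ext
        change x * (E : K) = e
        rw [hEe, mul_div_cancel₀ _ hx0]
      have hleib := δ'.leibniz ⟨x, hle hxR⟩ E
      rw [hxE] at hleib
      have hK := congrArg (fun z : R' => (z : K)) hleib
      simp only [smul_eq_mul, Subring.coe_add, Subring.coe_mul] at hK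
      rw [hδ'a e, hδ'a ⟨x, hxR⟩] at hK
      apply Subtype.ext
      change ((δ' E : R') : K) = ((δ e : R) : K) - ((δ ⟨x, hxR⟩ : R) : K) * (E : K)
      apply mul_left_cancel₀ hx0
      linear_combination -hK
    have h11 := hformula δ₁ δ₁' hδ₁'a hE₁
    have h12 := hformula δ₁ δ₁' hδ₁'a hE₂
    have h21 := hformula δ₂ δ₂' hδ₂'a hE₁
    have h22 := hformula δ₂ δ₂' hδ₂'a hE₂
    -- compare residues
    have hres : IsLocalRing.residue R' (δ₁' E₁ * δ₂' E₂ - δ₁' E₂ * δ₂' E₁) =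
        IsLocalRing.residue R' (Subring.inclusion hle (δ₁ e₁ * δ₂ e₂ - δ₁ e₂ * δ₂ e₁)) := by
      have hz₁ : IsLocalRing.residue R' E₁ = 0 := (IsLocalRing.residue_eq_zero_iff _).mpr hE₁m
      have hz₂ : IsLocalRing.residue R' E₂ = 0 := (IsLocalRing.residue_eq_zero_iff _).mpr hE₂m
      rw [h11, h12, h21, h22]
      simp only [map_sub, map_mul, hz₁, hz₂, mul_zero, sub_zero]
    have hunit' : IsUnit (Subring.inclusion hle (δ₁ e₁ * δ₂ e₂ - δ₁ e₂ * δ₂ e₁)) := hI3.map _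
    rw [← IsLocalRing.residue_ne_zero_iff_isUnit] at hunit' ⊢
    rwa [hres]
  -- §j domination
  have hdom : SubringDominates R R' := by
    refine ⟨hle, fun w hw hwinv => ?_⟩
    by_cases hw0 : w = 0
    · rw [hw0, inv_zero]; exact R.zero_mem
    by_contra hnot
    have hnu : ¬ IsUnit (⟨w, hw⟩ : R) := fun hu => hnot ((isUnit_subring_iff_inv_mem _).mp hu).2
    have hm : (⟨w, hw⟩ : R) ∈ maximalIdeal R := (IsLocalRing.mem_maximalIdeal _).mpr (mem_nonunits_iff.mpr hnu)
    have hm' : (⟨w, hle hw⟩ : R') ∈ maximalIdeal R' := (hval' _).mpr ((hval _).mp hm)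
    have hnu' : ¬ IsUnit (⟨w, hle hw⟩ : R') :=
      mem_nonunits_iff.mp ((IsLocalRing.mem_maximalIdeal _).mp hm')
    exact hnu' ((isUnit_subring_iff_inv_mem _).mpr ⟨hw0, hwinv⟩)
  exact ⟨hxu, hR'C, hdom, hval', hle', δ₁', δ₂', hE₁, hE₂, hI1', hI2', hI3'⟩

end Summit.ResolutionOfSingularities.ResolutionOfSingularities.Theorems.SwitchingDichotomy.CriticalThread

end
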